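import Summits.BirchSwinnertonDyer.Rank1Residual.Additive.TwistedBranchPAdicGrossZagier
import Summits.BirchSwinnertonDyer.Rank1Residual.Additive.TameBranchGrossZagier
import Summits.BirchSwinnertonDyer.Rank1Residual.Additive.TameBranchOfTwistBranch
import Summits.BirchSwinnertonDyer.Rank1Residual.Additive.TameBranchKatoDivisibilityOfDelbourgo
import Summits.BirchSwinnertonDyer.Rank1Residual.Additive.GordRankZeroChiBranch
import Literature.NumberTheory.EllipticCurves.Pal2012.QuadraticTwistPeriodProofs
import HarnessLib

/-!
# Row B6 (O7-ord), defect 2, E-NORMALISED CURRENCY: the period transport constant of the Legendre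
# twist relation is `±ϖ_V/ϖ_E` (Pal 2012), hence the typed tame-branch `p`-adic Gross–Zagier formula
# `TameBranchPAdicGrossZagierAt W p Dh` FOLLOWS from the twisted-branch clauses at defect 2
# (cell `bsd-addord`, FULL-BSD rank-≤ 1 programme D-0033 tranche 1a, seat `bsd-addord-gz`, session 3;
# TARGET.md R-O7″ (3): the L3.N1″ consumer "with the defect-2 fact supplied"; PROOF-gz2 Remark 0.3)

HONEST FRAMING. Theorems only: no definition, no named fact, no `sorry`, nothing booked, labels
UNCHANGED. The tree has TWO currencies for the analytic side on the defect-2 rows: the V-currency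
(`BranchPAdicGrossZagier{,Odd,Mult}At`: the `ω^{(p−1)/2}`-branch of the good/multiplicative twist
`V`, period index `ϖ_V·Ω_V = Ω⁺_{f_V}`) and the E-currency (`TameBranchPAdicGrossZagierAt`: every tuple
of the E-normalised package `IsTameBranchOf f_E p ε α B`, period index `ϖ_E·Ω_E = Ω⁺_{f_E}`). The
dictionary `TameBranchOfTwistBranch.lean` identifies every E-normalised branch with
`C(c)·L_p(f_V, α_V, ω^{(p−1)/2}, T)` for the constant `c` of the Legendre twist relation
`LegendreTwistPlusRel p f_E f_V c`, which the tree (`exists_legendreTwistPlusRel_of_cuspCoeff_eq`)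
leaves UNNORMALISED. §1 normalises it: **`c = ±ϖ_V/ϖ_E`** — from the complex identity
`Ω⁺_{f_E}·[s]⁺_{f_E} = τ(χ_p)⁻¹·Ω⁺_{f_V}·∑_u (u/p)[s+u/p]⁺_{f_V}` (`plusSymbol_eq_sum_of_cuspCoeff_eq`),
`τ(χ_p)² = p` (Mathlib `gaussSum_sq`, `p ≡ 1 (mod 4)`) and Pal 2012 Thm. 3.2 `√p·Ω_E = Ω_V` (tree
theorem `Pal2012.thm32_sqrt_mul_realPeriodRat_twist_eq_of_prime_one_mod_four_holds`), so that the
number `√p/τ(χ_p) ∈ {±1}` is the only ambiguity. §2 concludes, by tuple rigidity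
(`IsTameBranchOf.eq_zero_or_tuple_eq`), that on (G-ord, `e = 2`), `p ≡ 1 (mod 4)`, analytic rank one,
the twisted-branch clauses `TwistedBranchGrossZagierAt W p Dh` (the bare `Prop` of the Literature fact
`Disegni2017.delbourgoDatum_rankOne_leadingTerms`; REF-gz PASS with condition GZ-H) IMPLY the
E-normalised typed input `TameBranchPAdicGrossZagierAt W p Dh` for the same datum; §3 supplies the
L3.N1″ HEADLINE of `TameBranchGrossZagier.lean` with the defect-2 fact: the LOWER half of BSD_p on
(G-ord, `e = 2`) ∩ `p ≡ 1 (mod 4)` rank-one rows from print + the fact + one certified tame branch.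
REFEREE CONDITION GZ-H (binding locator for the fact, verbatim in substance): the height
identification behind the fact's Gross–Zagier half is Disegni 2017 Rem. 1.3.2's (n-exc)-conditional
printed sentence + Disegni 2022 Thm. B context, (n-exc) discharged by `ε_p` ramified; not Delbourgo
2002 p. 62; Nekovář 1993 §7.14 unheld (acq-10827). (These (G-ord) rows have `V` GOOD ordinary.)

## What is NOT claimed

Nothing at `p ≡ 3 (mod 4)` (odd branch: the minus relation and Pal's `d < 0` case carry the factor
`#components`; not done here), on (M), at defect `3,4,6`, at `p ≤ 3`; no booking; Schneider nowhere.

References: [Pal2012] Thm. 3.2, Prop. 2.5; [MazurTateTeitelbaum1986Invent] §I.8, §I.13–I.14;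
[Shimura1971] Prop. 3.64; [Delbourgo2002] Thm. (A), (B), (C) p. 40; [Disegni2017] Thm. B, Rem. 1.3.2;
[Miller2011LMS] Def. 1.1; cell memos PROOF-gz.md §3, PROOF-gz2.md Remark 0.3.
-/

noncomputable section

open scoped Classical MatrixGroups ModularForm NumberField

open CongruenceSubgroup WeierstrassCurve NumberField IsDedekindDomain
  Literature.NumberTheory.EllipticCurves Literature.NumberTheory.EllipticCurves.ModularForms
  Literature.NumberTheory.EllipticCurves.Rank1Residual
  Literature.NumberTheory.EllipticCurves.Rank1Residual.Typed
  Literature.NumberTheory.EllipticCurves.Delbourgo2002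
  Literature.NumberTheory.EllipticCurves.Disegni2017

namespace Summit.BirchSwinnertonDyer.Rank1Residual.Additive

variable {p : ℕ} [hp : Fact p.Prime]

/-! ### §1 The Legendre twist relation with its constant NORMALISED: `c = ±ϖ_V/ϖ_E` -/

/-- `τ(χ_p)² = p` for the quadratic character mod `p ≡ 1 (mod 4)` with values in `ℂ` (Mathlib's
`gaussSum_sq` with `χ_p(−1) = χ₄(p) = 1`). [folklore] -/
theorem gaussSum_quadraticChar_sq_eq_of_mod_four_eq_one (hp4 : p % 4 = 1) :
    gaussSum ((quadraticChar (ZMod p)).ringHomComp (Int.castRingHom ℂ)) (ZMod.stdAddChar (N := p)) ^ 2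
      = (p : ℂ) := by
  have hp2 : p ≠ 2 := by omega
  haveI : NeZero p := ⟨hp.out.ne_zero⟩
  have hchar : ringChar (ZMod p) ≠ 2 := by rw [ZMod.ringChar_zmod_n]; exact hp2
  have hne : (quadraticChar (ZMod p)).ringHomComp (Int.castRingHom ℂ) ≠ 1 :=
    (MulChar.ringHomComp_ne_one_iff Int.cast_injective).mpr (quadraticChar_ne_one hchar)
  have hquad : ((quadraticChar (ZMod p)).ringHomComp (Int.castRingHom ℂ)).IsQuadratic :=
    (quadraticChar_isQuadratic (ZMod p)).comp _
  rw [gaussSum_sq hne hquad (ZMod.isPrimitive_stdAddChar p), MulChar.ringHomComp_apply,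
    quadraticChar_neg_one hchar, ZMod.card, ZMod.χ₄_nat_one_mod_four hp4]
  simp

/-- **The Legendre twist relation NORMALISED (even branch).** For `E = W ≅ V ⊗ χ_p` additive at
`p ≡ 1 (mod 4)`, `V` globally minimal and semistable at `p`, `f`, `g` the newforms of `W`, `V`, and
period indices `ϖ·Ω_E = Ω⁺_f`, `ϖ'·Ω_V = Ω⁺_g`: the relation `[s]⁺_f = c·∑_{u mod p}(u/p)[s+u/p]⁺_g`
holds with **`c = ϖ'/ϖ` or `c = −ϖ'/ϖ`** — the complex identity behind
`exists_legendreTwistPlusRel_of_cuspCoeff_eq` reads `Ω⁺_f[s]⁺_f = τ⁻¹Ω⁺_g·(∑…)`, and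
`Ω⁺_g/(τΩ⁺_f) = (ϖ'/ϖ)·(√p/τ)` by Pal's `√p·Ω_E = Ω_V`, with `(√p/τ)² = 1`.
[cite: Pal2012, Thm. 3.2 (p. 1519) with Prop. 2.5] [cite: MazurTateTeitelbaum1986Invent, §I.8]
[cite: Shimura1971, Prop. 3.64] -/
theorem exists_legendreTwistPlusRel_eq_periodIndex (hp4 : p % 4 = 1)
    (V W : WeierstrassCurve ℚ) [V.IsElliptic] [V.IsGloballyMinimal] [W.IsElliptic]
    [W.IsGloballyMinimal] (hVW : ∃ C : VariableChange ℚ, C • V.quadraticTwist (p : ℚ) = W)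
    (hadd : Addv W p) (hV : V.HasGoodReductionAtPrime p ∨ V.HasMultiplicativeReductionAtPrime p)
    {N N' : ℕ} [NeZero N] [NeZero N'] {f : CuspForm (Gamma0 N) 2} {g : CuspForm (Gamma0 N') 2}
    (hf : IsNewformOf W f) (hg : IsNewformOf V g) (ϖ ϖ' : ℚ)
    (hϖ : (ϖ : ℝ) * W.realPeriodRat = plusPeriod f) (hϖ' : (ϖ' : ℝ) * V.realPeriodRat = plusPeriod g) :
    ∃ c : ℚ, LegendreTwistPlusRel p f g c ∧ (c = ϖ' / ϖ ∨ c = -(ϖ' / ϖ)) := by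
  obtain ⟨hp2, heven⟩ := ne_two_and_legendreSym_neg_one_of_mod_four_eq_one (p := p) hp4
  haveI : NeZero p := ⟨hp.out.ne_zero⟩
  have h := cuspCoeff_eq_legendreSym_mul_cuspCoeff_of_twist hp4 V W hVW hadd hf hg
  have hrealf : ∀ n, (cuspCoeff f n).im = 0 := cuspCoeff_im_eq_zero_of_coeffField_eq_bot hf.coeffField_eq_bot
  have hrealg : ∀ n, (cuspCoeff g n).im = 0 := cuspCoeff_im_eq_zero_of_coeffField_eq_bot hg.coeffField_eq_bot
  have hΩf : 0 < plusPeriod f := IsNewform0.plusPeriod_pos_holds hf.1 hf.coeffField_eq_bot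
  have hΩg : 0 < plusPeriod g := IsNewform0.plusPeriod_pos_holds hg.1 hg.coeffField_eq_bot
  have hPf : ∀ r : ℚ, plusSymbol f r = ((plusPeriod f * (ratPlusSymbol f r : ℝ) : ℝ) : ℂ) := by
    intro r
    have h1 := plusSymbol_eq_re_holds f hrealf r
    have h2 : (ratPlusSymbol f r : ℝ) = (plusSymbol f r).re / plusPeriod f :=
      ratCast_ratPlusSymbol_holds hf.1 hf.coeffField_eq_bot r
    have h3 : (plusSymbol f r).re = plusPeriod f * (ratPlusSymbol f r : ℝ) := by
      rw [h2]; field_simp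
    rw [← h3, h1, Complex.ofReal_re]
  have hPg : ∀ r : ℚ, plusSymbol g r = ((plusPeriod g * (ratPlusSymbol g r : ℝ) : ℝ) : ℂ) := by
    intro r
    have h1 := plusSymbol_eq_re_holds g hrealg r
    have h2 : (ratPlusSymbol g r : ℝ) = (plusSymbol g r).re / plusPeriod g :=
      ratCast_ratPlusSymbol_holds hg.1 hg.coeffField_eq_bot r
    have h3 : (plusSymbol g r).re = plusPeriod g * (ratPlusSymbol g r : ℝ) := by
      rw [h2]; field_simp
    rw [← h3, h1, Complex.ofReal_re]
  -- the Gauss sum `τ` and the twisted sums `q₂`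
  set τ : ℂ := gaussSum ((quadraticChar (ZMod p)).ringHomComp (Int.castRingHom ℂ))
    (ZMod.stdAddChar (N := p)) with hτ
  have hτsq : τ ^ 2 = (p : ℂ) := gaussSum_quadraticChar_sq_eq_of_mod_four_eq_one hp4
  have hpC : (p : ℂ) ≠ 0 := by exact_mod_cast hp.out.ne_zero
  have hτ0 : τ ≠ 0 := by
    intro h0; rw [h0, zero_pow two_ne_zero] at hτsq; exact hpC hτsq.symm
  set q₂ : ℚ → ℚ := fun s ↦
    ∑ u : ZMod p, (legendreSym p (u.val : ℤ) : ℚ) * ratPlusSymbol g (s + (u.val : ℚ) / p) with hq₂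
  have hC : ∀ s : ℚ, ((plusPeriod f : ℝ) : ℂ) * ((ratPlusSymbol f s : ℚ) : ℂ) =
      τ⁻¹ * ((plusPeriod g : ℝ) : ℂ) * ((q₂ s : ℚ) : ℂ) := by
    intro s
    have hs := plusSymbol_eq_sum_of_cuspCoeff_eq hp2 heven h s
    rw [hPf] at hs
    simp_rw [hPg] at hs
    rw [hq₂]
    push_cast at hs ⊢
    rw [hs, Finset.mul_sum, Finset.mul_sum]
    refine Finset.sum_congr rfl fun u _ ↦ ?_
    ring
  -- the periods: `Ω⁺_f = ϖ Ω_E`, `Ω⁺_g = ϖ' Ω_V = ϖ' √p Ω_E` (Pal)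
  have hPal : Real.sqrt p * W.realPeriodRat = V.realPeriodRat :=
    Pal2012.thm32_sqrt_mul_realPeriodRat_twist_eq_of_prime_one_mod_four_holds V W p hp4 hV hVW
  have hΩE : (W.realPeriodRat : ℂ) ≠ 0 := by exact_mod_cast W.realPeriodRat_pos_holds.ne'
  have hϖ0 : ϖ ≠ 0 := X2.varpi_ne_zero_of_isNewformOf hf hϖ
  have hϖC : (ϖ : ℂ) ≠ 0 := by exact_mod_cast hϖ0
  have hsqrt : ((Real.sqrt p : ℝ) : ℂ) ^ 2 = (p : ℂ) := by
    rw [← Complex.ofReal_pow, Real.sq_sqrt (Nat.cast_nonneg p)]; push_cast; rfl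
  -- `λ = √p / τ` has `λ² = 1`
  set lam : ℂ := ((Real.sqrt p : ℝ) : ℂ) * τ⁻¹ with hlam
  have hlam2 : lam * lam = 1 := by
    rw [hlam, ← pow_two, mul_pow, inv_pow, hsqrt, hτsq, mul_inv_cancel₀ hpC]
  have hlam1 : lam = 1 ∨ lam = -1 := mul_self_eq_one_iff.mp hlam2
  -- `[s]_f = λ (ϖ'/ϖ) q₂ s`
  have hkey : ∀ s : ℚ, ((ratPlusSymbol f s : ℚ) : ℂ) = lam * ((ϖ' / ϖ : ℚ) : ℂ) * ((q₂ s : ℚ) : ℂ) := by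
    intro s
    have hs := hC s
    have hf' : ((plusPeriod f : ℝ) : ℂ) = (ϖ : ℂ) * (W.realPeriodRat : ℂ) := by
      rw [← hϖ]; push_cast; ring
    have hg' : ((plusPeriod g : ℝ) : ℂ) = (ϖ' : ℂ) * (((Real.sqrt p : ℝ) : ℂ) * (W.realPeriodRat : ℂ)) := by
      rw [← hϖ', ← hPal]; push_cast; ring
    rw [hf', hg'] at hs
    rw [hlam]
    push_cast
    field_simp
    field_simp at hs
    linear_combination hs
  rcases hlam1 with h1 | h1
  · refine ⟨ϖ' / ϖ, fun s ↦ ?_, Or.inl rfl⟩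
    apply Rat.cast_injective (α := ℂ)
    have := hkey s
    rw [h1, one_mul] at this
    rw [this, hq₂]
    push_cast
    ring
  · refine ⟨-(ϖ' / ϖ), fun s ↦ ?_, Or.inr rfl⟩
    apply Rat.cast_injective (α := ℂ)
    have := hkey s
    rw [h1] at this
    rw [this, hq₂]
    push_cast
    ring

/-! ### §2 Defect 2, `p ≡ 1 (mod 4)`, (G-ord): the twisted-branch clauses give the E-normalised typed input -/

variable {W : WeierstrassCurve ℚ} [W.IsElliptic] [W.IsGloballyMinimal]

/-- **E-currency from V-currency at defect 2 (even branch).** For `E = W` additive at `p ≡ 1 (mod 4)`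
with a GOOD ORDINARY twist model `C • V^{(p)} = W`, `r_an(E) = 1`, and a height datum `Dh` carrying
the twisted-branch Gross–Zagier clauses `TwistedBranchGrossZagierAt W p Dh`: the E-normalised typed
input **`TameBranchPAdicGrossZagierAt W p Dh` holds** — for EVERY tuple `(f, ε, α, B)` of the package.
Proof: by the dictionary (`isTameBranchOf_legendre_C_mul_padicLFunctionBranch`) and tuple rigidity
(`IsTameBranchOf.eq_zero_or_tuple_eq`) every tuple with `‖α‖ = 1` has `B = C(c)·L_p(f_V, α_V, ω^{(p−1)/2}, T)`
(or `B = 0` when that series vanishes), with `c = ±ϖ_V/ϖ_E` (§1); so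
`ϖ_E·[T¹]B = ±ϖ_V·[T¹]L_p(f_V,…)` and the V-clause `ϖ_V[T¹]L_p·log_p γ = u·q·Reg_p(E,Dh)` is the
E-clause with the unit `±u` (in the vanishing case both sides are `0`). Modularity datum `hmodD` for
`V`'s newform. [cite: Pal2012, Thm. 3.2] [cite: MazurTateTeitelbaum1986Invent, §I.13–I.14 (14.3)]
[cite: Disegni2017, Thm. B (§1.3.2) (provenance of the clause `hTw`; nothing asserted)] -/
theorem tameBranchPAdicGrossZagierAt_of_twisted_of_goodOrd_twist (hp4 : p % 4 = 1)
    (hmodD : nonempty_modularParametrizationData)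
    (hGZK : rank_eq_analyticRank_of_analyticRank_le_one) (hadd : Addv W p)
    (V : WeierstrassCurve ℚ) [V.IsElliptic] [V.IsGloballyMinimal]
    (hVW : ∃ C : VariableChange ℚ, C • V.quadraticTwist (p : ℚ) = W) (hord : GoodOrd V p)
    (hr : W.analyticRank = 1) {Dh : PAdicHeightData W p} (hTw : TwistedBranchGrossZagierAt W p Dh) :
    TameBranchPAdicGrossZagierAt W p Dh := by
  intro N _ f ε α B hf _hε hα hB ϖ hϖ
  have hp2 : p ≠ 2 := by omega
  have hmw : W.mordellWeilRank = 1 := by rw [(hGZK W (by rw [hr])).1, hr]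
  have hordI : IsOrdinaryAt V p := hord
  haveI : NeZero (V.conductorNorm ℤ) := ⟨(V.conductorNorm_pos_holds).ne'⟩
  obtain ⟨Dm⟩ := hmodD V
  obtain ⟨ϖ', -, hϖ', -⟩ := Dm.exists_rat_mul_realPeriodRat_eq_plusPeriod
  obtain ⟨C, hC⟩ := hVW
  obtain ⟨c, hrel, hc⟩ := exists_legendreTwistPlusRel_eq_periodIndex hp4 V W ⟨C, hC⟩ hadd
    (Or.inl hord.1) hf Dm.isNewformOf ϖ ϖ' hϖ hϖ'
  have hnamed := isTameBranchOf_legendre_C_mul_padicLFunctionBranch V hp2 hordI Dm.isNewformOf hrel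
  -- the V-clause
  obtain ⟨q, hlead, heven, -⟩ := hTw hr V Dm.f (Or.inl hord.1) Dm.isNewformOf
  obtain ⟨u, hu⟩ := (heven C ϖ' hp4 hC hϖ').1 hordI
  rw [hmw, pow_one]
  have hϖ0 : ϖ ≠ 0 := X2.varpi_ne_zero_of_isNewformOf hf hϖ
  have hϖ'0 : ϖ' ≠ 0 := X2.varpi_ne_zero_of_isNewformOf Dm.isNewformOf hϖ'
  have hϖQ : ((ϖ : ℚ) : ℚ_[p]) ≠ 0 := by exact_mod_cast hϖ0
  have hc0 : (c : ℚ_[p]) ≠ 0 := by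
    have : c ≠ 0 := by
      rcases hc with hc | hc <;> rw [hc]
      · exact div_ne_zero hϖ'0 hϖ0
      · exact neg_ne_zero.mpr (div_ne_zero hϖ'0 hϖ0)
    exact_mod_cast this
  set L := padicLFunctionBranch Dm.f (unitRoot V p : ℚ_[p]) (p / 2) with hL
  by_cases hBn : PowerSeries.C (c : ℚ_[p]) * L = 0
  · -- the named branch vanishes: `L = 0`, so `q·Reg_p = 0` by the V-clause, and `B = 0` by rigidity
    have hL0 : L = 0 := by
      rcases mul_eq_zero.mp hBn with h | h
      · exact absurd (by simpa using congrArg (PowerSeries.constantCoeff) h) hc0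
      · exact h
    have hB0 : B = 0 := by
      by_contra hB0
      rcases hB.eq_zero_or_tuple_eq hp2 hnamed hB0 with ⟨hα0, -⟩ | ⟨-, -, hBB⟩
      · exact (unitRoot_coe_spec (W := V) (p := p) hordI).2.2 hα0
      · exact hB0 (hBB ▸ hBn)
    have hqR : (q : ℚ_[p]) * padicRegulator Dh = 0 := by
      have h0 : (ϖ' : ℚ_[p]) * PowerSeries.coeff 1 L * padicLog p (cyclotomicGenerator p) = 0 := by
        rw [hL0, map_zero, mul_zero, zero_mul]
      rw [hu, mul_assoc] at h0
      rcases mul_eq_zero.mp h0 with h | h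
      · exact absurd h (coe_units_ne_zero p u)
      · exact h
    refine ⟨u, q, hlead, ?_⟩
    rw [hB0, map_zero, mul_zero, zero_mul, mul_assoc, hqR, mul_zero]
  · -- the named branch is non-zero: our tuple IS it
    rcases hnamed.eq_zero_or_tuple_eq hp2 hB hBn with ⟨hα0, -⟩ | ⟨-, -, hBB⟩
    · exact absurd (by rw [hα0, norm_zero] : ‖α‖ = 0) (by rw [hα]; exact one_ne_zero)
    · rcases hc with hc | hc
      · refine ⟨u, q, hlead, ?_⟩
        rw [hBB, PowerSeries.coeff_C_mul, hc, ← hu]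
        push_cast
        field_simp
      · refine ⟨-u, q, hlead, ?_⟩
        rw [hBB, PowerSeries.coeff_C_mul, hc, Units.val_neg, PadicInt.coe_neg, neg_mul, neg_mul, ← hu]
        push_cast
        field_simp

/-! ### §3 The E-currency datum from the defect-2 fact, and the L3.N1″ HEADLINE supplied -/

/-- **The defect-2 fact in E-currency, (G-ord, `e = 2`), `p ≡ 1 (mod 4)`** (`p ≥ 5` automatic): for
`W` globally minimal, non-CM, additive (G)-ordinary of defect 2 at `p`, `r_an(E) = 1`, the named fact
`delbourgoDatum_rankOne_leadingTerms` (displayed, `hFact`) gives ONE datum `Dh` with Delbourgo's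
(B)-clauses AND the E-normalised typed input `TameBranchPAdicGrossZagierAt W p Dh` — the conclusion of
the cell's defect-3/4/6 `Prop`, here a THEOREM modulo the defect-2 fact (§2 + the (G-ord) twist model
`TypeGOrd.exists_goodOrd_pStar_twist_model`). [cite: Delbourgo2002, Theorem (B) (p. 40)]
[cite: Pal2012, Thm. 3.2] [cite: Disegni2017, Thm. B (§1.3.2) (provenance of `hFact`; nothing asserted)] -/
theorem exists_leadingTermClauses_and_tameBranchPAdicGrossZagierAt_of_delbourgoDatumFact
    (hFact : delbourgoDatum_rankOne_leadingTerms) (hmodD : nonempty_modularParametrizationData)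
    (hGZK : rank_eq_analyticRank_of_analyticRank_le_one) (hp4 : p % 4 = 1) (hcm : ¬ W.HasCM)
    (hadd : Addv W p) (hG : TypeGOrd W p) (he : semistabilityIndex W p = 2)
    (hr : W.analyticRank = 1) :
    ∃ Dh : PAdicHeightData W p, LeadingTermClauses W p Dh ∧ TameBranchPAdicGrossZagierAt W p Dh := by
  have hp2 : p ≠ 2 := by omega
  have hp5 : 5 ≤ p := by have := hp.out.two_le; omega
  have hev : Even (p / 2) := ⟨p / 4, by omega⟩
  obtain ⟨Dh, hB, hTw⟩ := hFact W p hp2 hcm hadd hr (Or.inl ⟨hp5, hG⟩)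
  obtain ⟨V, iV, iVm, C, hV, hC⟩ := TypeGOrd.exists_goodOrd_pStar_twist_model W p hp2 hG hadd he
  have hps : ((-1 : ℚ) ^ (p / 2) * (p : ℚ)) = (p : ℚ) := by rw [hev.neg_one_pow, one_mul]
  exact ⟨Dh, hB, tameBranchPAdicGrossZagierAt_of_twisted_of_goodOrd_twist hp4 hmodD hGZK hadd V
    ⟨C, by rw [← hps]; exact hC⟩ hV hr hTw⟩

/-- **L3.N1″ HEADLINE SUPPLIED at defect 2, `p ≡ 1 (mod 4)`: the LOWER half `ord_p #Ш_an ≤ ord_p #Ш`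
(`Typed.MissingLowerBoundAt W p`) on (G-ord, `e = 2`) rank-one rows from PRINT + the defect-2 fact +
ONE certified E-normalised tame branch** (R-O7″ (3) in its own words). Printed binders: Delbourgo 2002
(A)+(B) `hDel`, (C) `hC` (A227, via `tameBranchRatDvdAt_of_thmC`, whose (M)-row binder `hDelM` rides
along), GZK, a modular parametrisation datum `hmodD`; displayed non-published binder: `hFact`. Per
pair: the tuple `(f, ε, α, B)` with `B` `p`-integral and `‖[T¹]B‖_p = 1`, the period index `ϖ` with
`ord_p ϖ ≤ 0`, non-CM, non-anomalous, `#Ш_an = s`. (The V-currency route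
`TwistedBranchPAdicGrossZagierBSD.lean` reaches `BSDp` on the big-image rows; this is the image-free
LOWER half in Delbourgo's own currency.) Nothing booked.
[cite: Delbourgo2002, Theorem (A), (B), (C) (p. 40)] [cite: Miller2011LMS, Def. 1.1] -/
theorem missingLowerBoundAt_rankOne_two_of_delbourgoDatumFact_of_thmC_of_cert
    (hFact : delbourgoDatum_rankOne_leadingTerms)
    (hC : Delbourgo2002.thmC_charIdeal_dvd_tameBranch) (hDel : Delbourgo2002.mainTheorem)
    (hDelM : Delbourgo2002.mainTheorem_potMult) (hmodD : nonempty_modularParametrizationData)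
    (hGZK : rank_eq_analyticRank_of_analyticRank_le_one)
    (hp4 : p % 4 = 1) (hcm : ¬ W.HasCM) (hadd : Addv W p) (hG : TypeGOrd W p)
    (he : semistabilityIndex W p = 2) (hr : W.analyticRank = 1) (hna : ReductionNonAnomalous W p)
    {N : ℕ} [NeZero N] {f : CuspForm (Gamma0 N) 2} {ε : DirichletCharacter ℂ_[p] p} {α : ℚ_[p]}
    {B : PowerSeries ℚ_[p]}
    (hf : IsNewformOf W f) (hε : orderOf ε = tameDefect W p) (hα : ‖α‖ = 1)
    (hB : IsTameBranchOf f p ε α B) (hint : ∀ j : ℕ, ‖PowerSeries.coeff j B‖ ≤ 1)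
    (hunit : ‖PowerSeries.coeff 1 B‖ = 1)
    (ϖ : ℚ) (hϖ : (ϖ : ℝ) * W.realPeriodRat = plusPeriod f) (hϖv : padicValRat p ϖ ≤ 0)
    {s : ℚ} (hs : shaAn W = (s : ℂ)) :
    MissingLowerBoundAt W p := by
  have hp2 : p ≠ 2 := by omega
  have hp5 : 5 ≤ p := by have := hp.out.two_le; omega
  obtain ⟨Dh, hBcl, hGZ⟩ :=
    exists_leadingTermClauses_and_tameBranchPAdicGrossZagierAt_of_delbourgoDatumFact hFact hmodD hGZK hp4
      hcm hadd hG he hr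
  exact missingLowerBoundAt_rankOne_of_tameBranchRatDvdAt_of_tameBranchPAdicGrossZagier
    (tameBranchRatDvdAt_of_thmC hC hDel hDelM hp5 hcm) hp2 hadd (Or.inr hG) hf hε hα hB hint hunit ϖ hϖ
    hϖv hBcl hGZ (fun κ γ hκ hγ D ↦ hDel.isTorsion hp5 hcm hadd hG hκ hγ D) hGZK hr hna hs

end Summit.BirchSwinnertonDyer.Rank1Residual.Additive

end
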